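import Literature.Analysis.FluidPDE.WaveKinetic
import Mathlib.Analysis.SpecialFunctions.JapaneseBracket
import Mathlib.MeasureTheory.Constructions.HaarToSphere
import Mathlib.Analysis.InnerProductSpace.Projection.Reflection
import Mathlib.MeasureTheory.Integral.Prod
import Mathlib.MeasureTheory.Group.Integral
import HarnessLib

/-!
# Weighted sup-norm bounds for the cubic wave-kinetic collision operator

Analytic infrastructure for the local well-posedness of the cubic (four-wave) wave kinetic
equation `∂ₜ n = 𝒦(n)` of `Literature.Analysis.FluidPDE.WaveKinetic` in polynomially weighted
sup-norm classes `|n(k)| ≤ N (1 + ‖k‖)^{-s}` (Germain–Ionescu–Tran, J. Funct. Anal. 279 (2020)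
108570, Thm 2.1 / Prop 2.3 [GermainIonescuTran2020], here in a non-optimal range of exponents
`s > 2 dim E` and with elementary proofs).

Everything is stated for the concrete parametrisation of the resonant manifold used in
`WaveKinetic.collision`: `k₁ = k + a`, `k₃ = k + b`, `k₂ = k + a + b` with `b ∈ (ℝ ∙ a)ᗮ` and the
coarea weight `(2‖a‖)⁻¹`.

## Contents

* elementary inequalities for the weights `(1 + ‖x‖)^{-s}` (Peetre, products, resonance);
* uniform bounds for integrals of `(1 + ‖c + b‖)^{-σ}` over linear subspaces (hyperplanes);
* local integrability of `‖a‖⁻¹` and the outer (coarea-weighted) integral bound;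
* a Householder reparametrisation of the hyperplanes `(ℝ ∙ a)ᗮ` giving measurability in `a` of
  hyperplane integrals;
* the core iterated-integral bound, `WKEIntegrable`, and tame / Lipschitz bounds for `collision`.

No new definitions are introduced (all constants are existentially quantified). This file is
the analytic half of the proof of `WaveKinetic.exists_isWKESolutionOn_local`.

## References

* P. Germain, A. D. Ionescu, M.-B. Tran, *Optimal local well-posedness theory for the kinetic
  wave equation*, J. Funct. Anal. 279 (2020) 108570, Thm 2.1, Prop 2.3, Rem 2.6.
-/

open MeasureTheory Set Filter Topology Metric
open scoped InnerProductSpace ENNReal NNReal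

namespace Literature.Analysis.FluidPDE

noncomputable section

namespace WaveKinetic

section Weights

variable {E : Type*} [NormedAddCommGroup E]

/-- Peetre-type comparison used repeatedly: if `1 + ‖k‖ ≤ 2 (1 + ‖z‖)` then
`(1 + ‖z‖)^{-s} ≤ 2^s (1 + ‖k‖)^{-s}` for `s ≥ 0`. [folklore] -/
theorem wt_le_two_rpow_mul {s : ℝ} (hs : 0 ≤ s) {k z : E} (h : 1 + ‖k‖ ≤ 2 * (1 + ‖z‖)) :
    (1 + ‖z‖) ^ (-s) ≤ (2 : ℝ) ^ s * (1 + ‖k‖) ^ (-s) := by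
  have hz : (0 : ℝ) < 1 + ‖z‖ := by positivity
  have hk : (0 : ℝ) < 1 + ‖k‖ := by positivity
  rw [Real.rpow_neg hz.le, Real.rpow_neg hk.le]
  have h2 : (1 + ‖k‖) ^ s ≤ (2 : ℝ) ^ s * (1 + ‖z‖) ^ s := by
    rw [← Real.mul_rpow (by norm_num) hz.le]
    exact Real.rpow_le_rpow hk.le h hs
  have hzs : (0 : ℝ) < (1 + ‖z‖) ^ s := Real.rpow_pos_of_pos hz s
  have hks : (0 : ℝ) < (1 + ‖k‖) ^ s := Real.rpow_pos_of_pos hk s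
  have h2s : (0 : ℝ) < (2 : ℝ) ^ s := Real.rpow_pos_of_pos (by norm_num) s
  rw [inv_le_iff_one_le_mul₀ hzs]
  calc (1 : ℝ) = ((1 + ‖k‖) ^ s)⁻¹ * (1 + ‖k‖) ^ s := by rw [inv_mul_cancel₀ hks.ne']
    _ ≤ ((1 + ‖k‖) ^ s)⁻¹ * ((2 : ℝ) ^ s * (1 + ‖z‖) ^ s) := by gcongr
    _ = (2 : ℝ) ^ s * ((1 + ‖k‖) ^ s)⁻¹ * (1 + ‖z‖) ^ s := by ring

/-- The weight `(1 + ‖x‖)^{-s}` is positive. [folklore] -/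
theorem wt_pos (s : ℝ) (x : E) : (0 : ℝ) < (1 + ‖x‖) ^ (-s) :=
  Real.rpow_pos_of_pos (by positivity) _

/-- The weight `(1 + ‖x‖)^{-s}` is at most `1` for `s ≥ 0`. [folklore] -/
theorem wt_le_one {s : ℝ} (hs : 0 ≤ s) (x : E) : (1 + ‖x‖) ^ (-s) ≤ (1 : ℝ) :=
  Real.rpow_le_one_of_one_le_of_nonpos (by simp) (by linarith)

/-- The weight `(1 + ‖x‖)^{-s}` is antitone in `‖x‖` for `s ≥ 0`. [folklore] -/
theorem wt_anti_norm {s : ℝ} (hs : 0 ≤ s) {x y : E} (h : ‖x‖ ≤ ‖y‖) :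
    (1 + ‖y‖) ^ (-s) ≤ (1 + ‖x‖) ^ (-s) :=
  Real.rpow_le_rpow_of_nonpos (by positivity) (by linarith) (by linarith)

/-- The weight `(1 + ‖x‖)^{-s}` is antitone in the exponent `s`. [folklore] -/
theorem wt_anti_exp {s s' : ℝ} (h : s ≤ s') (x : E) :
    (1 + ‖x‖) ^ (-s') ≤ (1 + ‖x‖) ^ (-s) :=
  Real.rpow_le_rpow_of_exponent_le (by simp) (by linarith)

/-- Splitting of the weight: `(1 + ‖x‖)^{-2σ} = (1 + ‖x‖)^{-σ} (1 + ‖x‖)^{-σ}`. [folklore] -/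
theorem wt_two_mul (σ : ℝ) (x : E) :
    (1 + ‖x‖) ^ (-(2 * σ)) = (1 + ‖x‖) ^ (-σ) * (1 + ‖x‖) ^ (-σ) := by
  rw [← Real.rpow_add (by positivity)]; ring_nf

/-- Peetre's inequality `(1 + ‖x + y‖)^{-s} ≤ (1 + ‖y‖)^s (1 + ‖x‖)^{-s}` for `s ≥ 0`. [folklore] -/
theorem wt_add_le {s : ℝ} (hs : 0 ≤ s) (x y : E) :
    (1 + ‖x + y‖) ^ (-s) ≤ (1 + ‖y‖) ^ s * (1 + ‖x‖) ^ (-s) := by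
  have hx : (0 : ℝ) < 1 + ‖x‖ := by positivity
  have hy : (0 : ℝ) < 1 + ‖y‖ := by positivity
  have hxy : (0 : ℝ) < 1 + ‖x + y‖ := by positivity
  have h1 : 1 + ‖x‖ ≤ (1 + ‖x + y‖) * (1 + ‖y‖) := by
    have : ‖x‖ ≤ ‖x + y‖ + ‖y‖ := by
      calc ‖x‖ = ‖(x + y) - y‖ := by rw [add_sub_cancel_right]
        _ ≤ ‖x + y‖ + ‖y‖ := norm_sub_le _ _
    nlinarith [norm_nonneg (x + y), norm_nonneg y]
  rw [Real.rpow_neg hx.le, Real.rpow_neg hxy.le]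
  have h2 : (1 + ‖x‖) ^ s ≤ (1 + ‖x + y‖) ^ s * (1 + ‖y‖) ^ s := by
    rw [← Real.mul_rpow hxy.le hy.le]
    exact Real.rpow_le_rpow hx.le h1 hs
  have hxs : (0 : ℝ) < (1 + ‖x‖) ^ s := Real.rpow_pos_of_pos hx s
  have hys : (0 : ℝ) < (1 + ‖y‖) ^ s := Real.rpow_pos_of_pos hy s
  have hxys : (0 : ℝ) < (1 + ‖x + y‖) ^ s := Real.rpow_pos_of_pos hxy s
  rw [inv_le_iff_one_le_mul₀ hxys]
  calc (1 : ℝ) = ((1 + ‖x‖) ^ s)⁻¹ * (1 + ‖x‖) ^ s := by rw [inv_mul_cancel₀ hxs.ne']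
    _ ≤ ((1 + ‖x‖) ^ s)⁻¹ * ((1 + ‖x + y‖) ^ s * (1 + ‖y‖) ^ s) := by gcongr
    _ = (1 + ‖y‖) ^ s * ((1 + ‖x‖) ^ s)⁻¹ * (1 + ‖x + y‖) ^ s := by ring

/-- Product bound: `(1 + ‖x‖)^{-s} (1 + ‖y‖)^{-s} ≤ 2^s (1 + ‖x - y‖)^{-s}` for `s ≥ 0` (the larger
of `‖x‖, ‖y‖` is at least `‖x - y‖ / 2`). [folklore] -/
theorem wt_mul_wt_le {s : ℝ} (hs : 0 ≤ s) (x y : E) :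
    (1 + ‖x‖) ^ (-s) * (1 + ‖y‖) ^ (-s) ≤ (2 : ℝ) ^ s * (1 + ‖x - y‖) ^ (-s) := by
  rcases le_total ‖x‖ ‖y‖ with hxy | hxy
  · have h : 1 + ‖x - y‖ ≤ 2 * (1 + ‖y‖) := by linarith [norm_sub_le x y]
    calc (1 + ‖x‖) ^ (-s) * (1 + ‖y‖) ^ (-s) ≤ 1 * (1 + ‖y‖) ^ (-s) := by
          gcongr
          exact wt_le_one hs x
      _ ≤ (2 : ℝ) ^ s * (1 + ‖x - y‖) ^ (-s) := by
          rw [one_mul]; exact wt_le_two_rpow_mul hs h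
  · have h : 1 + ‖x - y‖ ≤ 2 * (1 + ‖x‖) := by linarith [norm_sub_le x y]
    calc (1 + ‖x‖) ^ (-s) * (1 + ‖y‖) ^ (-s) ≤ (1 + ‖x‖) ^ (-s) * 1 := by
          gcongr
          exact wt_le_one hs y
      _ ≤ (2 : ℝ) ^ s * (1 + ‖x - y‖) ^ (-s) := by
          rw [mul_one]; exact wt_le_two_rpow_mul hs h

end Weights

section InnerWeights

variable {E : Type*} [NormedAddCommGroup E] [InnerProductSpace ℝ E]

/-- On the resonant manifold (`b ⊥ a`) one has `‖k + a‖² + ‖k + b‖² = ‖k‖² + ‖k + a + b‖²`.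
[folklore] -/
theorem resonance_identity (k a b : E) (hab : ⟪a, b⟫_ℝ = 0) :
    ‖k + a‖ ^ 2 + ‖k + b‖ ^ 2 = ‖k‖ ^ 2 + ‖k + a + b‖ ^ 2 := by
  have hba : ⟪b, a⟫_ℝ = 0 := by rw [real_inner_comm]; exact hab
  simp only [← real_inner_self_eq_norm_sq, inner_add_left, inner_add_right, hab, hba]
  ring

/-- On the resonant manifold, one of `k + a`, `k + b` carries the weight of `k`:
`(1 + ‖k + a‖)^{-s} ≤ 2^s (1 + ‖k‖)^{-s}` or `(1 + ‖k + b‖)^{-s} ≤ 2^s (1 + ‖k‖)^{-s}`. [folklore] -/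
theorem wt_resonant_or {s : ℝ} (hs : 0 ≤ s) (k a b : E) (hab : ⟪a, b⟫_ℝ = 0) :
    (1 + ‖k + a‖) ^ (-s) ≤ (2 : ℝ) ^ s * (1 + ‖k‖) ^ (-s) ∨
      (1 + ‖k + b‖) ^ (-s) ≤ (2 : ℝ) ^ s * (1 + ‖k‖) ^ (-s) := by
  have hid := resonance_identity k a b hab
  rcases le_total ‖k + b‖ ‖k + a‖ with h | h
  · left
    apply wt_le_two_rpow_mul hs
    have h1 : ‖k‖ ^ 2 ≤ (2 * ‖k + a‖) ^ 2 := by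
      nlinarith [norm_nonneg (k + a + b), norm_nonneg (k + b), norm_nonneg (k + a), sq_nonneg ‖k + a + b‖]
    have h2 : ‖k‖ ≤ 2 * ‖k + a‖ := by
      nlinarith [norm_nonneg k, norm_nonneg (k + a)]
    linarith
  · right
    apply wt_le_two_rpow_mul hs
    have h1 : ‖k‖ ^ 2 ≤ (2 * ‖k + b‖) ^ 2 := by
      nlinarith [norm_nonneg (k + a + b), norm_nonneg (k + b), norm_nonneg (k + a), sq_nonneg ‖k + a + b‖]
    have h2 : ‖k‖ ≤ 2 * ‖k + b‖ := by
      nlinarith [norm_nonneg k, norm_nonneg (k + b)]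
    linarith

/-- For `b ⊥ a`, `‖a‖ ≤ ‖a - b‖`. [folklore] -/
theorem norm_le_norm_sub_of_inner_eq_zero (a b : E) (hab : ⟪a, b⟫_ℝ = 0) : ‖a‖ ≤ ‖a - b‖ := by
  have h := norm_sub_sq_eq_norm_sq_add_norm_sq_real hab
  have h2 : ‖a‖ ^ 2 ≤ ‖a - b‖ ^ 2 := by nlinarith [norm_nonneg b]
  exact le_of_pow_le_pow_left₀ two_ne_zero (norm_nonneg _) h2

/-- The geometric dominating function on the resonant manifold: for `b ⊥ a` and `σ ≥ 0`,
`w₀(k₂)w₀(k₃) + w₀(k₁)w₀(k₃) + w₀(k₁)w₀(k₂) ≤ 2·2^σ w_σ(a) w_σ(k₃) + w_σ(k₁) w_σ(k₂)` where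
`w₀ = (1 + ‖·‖)^{-2σ}`, `w_σ = (1 + ‖·‖)^{-σ}`, `k₁ = k + a`, `k₂ = k + a + b`, `k₃ = k + b`.
[folklore] -/
theorem resonant_weights_le {σ : ℝ} (hσ : 0 ≤ σ) (k a b : E) (hab : ⟪a, b⟫_ℝ = 0) :
    (1 + ‖k + a + b‖) ^ (-(2 * σ)) * (1 + ‖k + b‖) ^ (-(2 * σ))
        + (1 + ‖k + a‖) ^ (-(2 * σ)) * (1 + ‖k + b‖) ^ (-(2 * σ))
        + (1 + ‖k + a‖) ^ (-(2 * σ)) * (1 + ‖k + a + b‖) ^ (-(2 * σ)) ≤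
      2 * (2 : ℝ) ^ σ * (1 + ‖a‖) ^ (-σ) * (1 + ‖k + b‖) ^ (-σ)
        + (1 + ‖k + a‖) ^ (-σ) * (1 + ‖k + a + b‖) ^ (-σ) := by
  have h2σ : σ ≤ 2 * σ := by linarith
  have n1 := (wt_pos σ (k + a)).le
  have n2 := (wt_pos σ (k + a + b)).le
  have n3 := (wt_pos σ (k + b)).le
  have na := (wt_pos σ a).le
  have l1 := wt_le_one hσ (k + a)
  have l2 := wt_le_one hσ (k + a + b)
  have l3 := wt_le_one hσ (k + b)
  -- term 1
  have t1 : (1 + ‖k + a + b‖) ^ (-(2 * σ)) * (1 + ‖k + b‖) ^ (-(2 * σ)) ≤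
      (2 : ℝ) ^ σ * (1 + ‖a‖) ^ (-σ) * (1 + ‖k + b‖) ^ (-σ) := by
    have h := wt_mul_wt_le hσ (k + a + b) (k + b)
    have hab' : k + a + b - (k + b) = a := by abel
    rw [hab'] at h
    rw [wt_two_mul, wt_two_mul]
    calc (1 + ‖k + a + b‖) ^ (-σ) * (1 + ‖k + a + b‖) ^ (-σ) *
          ((1 + ‖k + b‖) ^ (-σ) * (1 + ‖k + b‖) ^ (-σ))
        = ((1 + ‖k + a + b‖) ^ (-σ) * (1 + ‖k + b‖) ^ (-σ)) *
          ((1 + ‖k + a + b‖) ^ (-σ) * (1 + ‖k + b‖) ^ (-σ)) := by ring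
      _ ≤ ((2 : ℝ) ^ σ * (1 + ‖a‖) ^ (-σ)) * (1 * (1 + ‖k + b‖) ^ (-σ)) := by
          gcongr
      _ = (2 : ℝ) ^ σ * (1 + ‖a‖) ^ (-σ) * (1 + ‖k + b‖) ^ (-σ) := by ring
  -- term 2
  have t2 : (1 + ‖k + a‖) ^ (-(2 * σ)) * (1 + ‖k + b‖) ^ (-(2 * σ)) ≤
      (2 : ℝ) ^ σ * (1 + ‖a‖) ^ (-σ) * (1 + ‖k + b‖) ^ (-σ) := by
    have h := wt_mul_wt_le hσ (k + a) (k + b)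
    have hab' : k + a - (k + b) = a - b := by abel
    rw [hab'] at h
    have hmono : (1 + ‖a - b‖) ^ (-σ) ≤ (1 + ‖a‖) ^ (-σ) :=
      wt_anti_norm hσ (norm_le_norm_sub_of_inner_eq_zero a b hab)
    rw [wt_two_mul, wt_two_mul]
    calc (1 + ‖k + a‖) ^ (-σ) * (1 + ‖k + a‖) ^ (-σ) *
          ((1 + ‖k + b‖) ^ (-σ) * (1 + ‖k + b‖) ^ (-σ))
        = ((1 + ‖k + a‖) ^ (-σ) * (1 + ‖k + b‖) ^ (-σ)) *
          ((1 + ‖k + a‖) ^ (-σ) * (1 + ‖k + b‖) ^ (-σ)) := by ring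
      _ ≤ ((2 : ℝ) ^ σ * (1 + ‖a - b‖) ^ (-σ)) * (1 * (1 + ‖k + b‖) ^ (-σ)) := by
          gcongr
      _ ≤ ((2 : ℝ) ^ σ * (1 + ‖a‖) ^ (-σ)) * (1 * (1 + ‖k + b‖) ^ (-σ)) := by
          gcongr
      _ = (2 : ℝ) ^ σ * (1 + ‖a‖) ^ (-σ) * (1 + ‖k + b‖) ^ (-σ) := by ring
  -- term 3
  have t3 : (1 + ‖k + a‖) ^ (-(2 * σ)) * (1 + ‖k + a + b‖) ^ (-(2 * σ)) ≤
      (1 + ‖k + a‖) ^ (-σ) * (1 + ‖k + a + b‖) ^ (-σ) := by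
    exact mul_le_mul (wt_anti_exp h2σ _) (wt_anti_exp h2σ _) (wt_pos _ _).le (wt_pos _ _).le
  linarith

end InnerWeights

section Domination

variable {E : Type*} [NormedAddCommGroup E] [InnerProductSpace ℝ E]

/-- `|x y z| ≤ A B C` from `|x| ≤ A`, `|y| ≤ B`, `|z| ≤ C`. [folklore] -/
theorem abs_mul_three_le {x y z A B C : ℝ} (hx : |x| ≤ A) (hy : |y| ≤ B) (hz : |z| ≤ C) :
    |x * y * z| ≤ A * B * C := by
  have hA : 0 ≤ A := (abs_nonneg x).trans hx
  have hB : 0 ≤ B := (abs_nonneg y).trans hy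
  rw [abs_mul, abs_mul]
  calc |x| * |y| * |z| ≤ A * B * |z| :=
        mul_le_mul_of_nonneg_right (mul_le_mul hx hy (abs_nonneg y) hA) (abs_nonneg z)
    _ ≤ A * B * C := mul_le_mul_of_nonneg_left hz (mul_nonneg hA hB)

/-- **Pointwise domination of the cubic wave-kinetic integrand** (tame form). For the trilinear
form `T(p,q,r)(k,k₁,k₂,k₃) = p₁q₂r₃ − p q₂r₃ + p q₁r₃ − p q₁r₂` (so that
`cubicForm n k k₁ k₂ k₃ = T(n,n,n)`), evaluated on the resonant parametrisation `k₁ = k + a`,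
`k₂ = k + a + b`, `k₃ = k + b` with `b ⊥ a`: if `|p| ≤ P₀ w₀`, `|p| ≤ P' w'`, `|q| ≤ Q₀ w₀`,
`|r| ≤ R₀ w₀`, `|r| ≤ R' w'` with `w₀ = (1 + ‖·‖)^{-s₀}`, `w' = (1 + ‖·‖)^{-s'}`, then
`|T| ≤ 4 · 2^{s'} w'(k) Q₀ (P' R₀ + P₀ R') · G` with
`G = w₀(k₂) w₀(k₃) + w₀(k₁) w₀(k₃) + w₀(k₁) w₀(k₂)`; the high weight `w'` never enters `G`
(cf. Germain–Ionescu–Tran 2020, proof of Prop 2.3). [folklore] -/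
theorem cubic_dom {s₀ s' : ℝ} (hs' : 0 ≤ s') {p q r : E → ℝ}
    {P₀ P' Q₀ R₀ R' : ℝ} (hP₀ : 0 ≤ P₀) (hP' : 0 ≤ P') (hQ₀ : 0 ≤ Q₀) (hR₀ : 0 ≤ R₀)
    (hR' : 0 ≤ R')
    (hp₀ : ∀ x, |p x| ≤ P₀ * (1 + ‖x‖) ^ (-s₀)) (hp' : ∀ x, |p x| ≤ P' * (1 + ‖x‖) ^ (-s'))
    (hq₀ : ∀ x, |q x| ≤ Q₀ * (1 + ‖x‖) ^ (-s₀))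
    (hr₀ : ∀ x, |r x| ≤ R₀ * (1 + ‖x‖) ^ (-s₀)) (hr' : ∀ x, |r x| ≤ R' * (1 + ‖x‖) ^ (-s'))
    (k a b : E) (hab : ⟪a, b⟫_ℝ = 0) :
    |p (k + a) * q (k + a + b) * r (k + b) - p k * q (k + a + b) * r (k + b)
        + p k * q (k + a) * r (k + b) - p k * q (k + a) * r (k + a + b)| ≤
      4 * (2 : ℝ) ^ s' * (1 + ‖k‖) ^ (-s') * (Q₀ * (P' * R₀ + P₀ * R')) *
        ((1 + ‖k + a + b‖) ^ (-s₀) * (1 + ‖k + b‖) ^ (-s₀)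
          + (1 + ‖k + a‖) ^ (-s₀) * (1 + ‖k + b‖) ^ (-s₀)
          + (1 + ‖k + a‖) ^ (-s₀) * (1 + ‖k + a + b‖) ^ (-s₀)) := by
  have hres := wt_resonant_or hs' k a b hab
  have h2s : (1 : ℝ) ≤ 2 ^ s' := Real.one_le_rpow (by norm_num) hs'
  have hpa' := hp' (k + a)
  have hpa₀ := hp₀ (k + a)
  have hpk := hp' k
  have hqab := hq₀ (k + a + b)
  have hqa := hq₀ (k + a)
  have hrb₀ := hr₀ (k + b)
  have hrb' := hr' (k + b)
  have hrab := hr₀ (k + a + b)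
  have nwk := (wt_pos s' k).le
  have nw₁ := (wt_pos s₀ (k + a)).le
  have nw₂ := (wt_pos s₀ (k + a + b)).le
  have nw₃ := (wt_pos s₀ (k + b)).le
  have nw₁' := (wt_pos s' (k + a)).le
  have nw₃' := (wt_pos s' (k + b)).le
  generalize (2 : ℝ) ^ s' = C₂ at *
  generalize (1 + ‖k‖) ^ (-s') = wk at *
  generalize (1 + ‖k + a‖) ^ (-s₀) = w₁ at *
  generalize (1 + ‖k + a + b‖) ^ (-s₀) = w₂ at *
  generalize (1 + ‖k + b‖) ^ (-s₀) = w₃ at *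
  generalize (1 + ‖k + a‖) ^ (-s') = w₁' at *
  generalize (1 + ‖k + b‖) ^ (-s') = w₃' at *
  generalize p (k + a) = pa at *
  generalize p k = pk at *
  generalize q (k + a + b) = qab at *
  generalize q (k + a) = qa at *
  generalize r (k + b) = rb at *
  generalize r (k + a + b) = rab at *
  have hC₂ : 0 ≤ C₂ := zero_le_one.trans h2s
  have hin : P' * R₀ ≤ P' * R₀ + P₀ * R' := le_add_of_nonneg_right (mul_nonneg hP₀ hR')
  have hin' : P₀ * R' ≤ P' * R₀ + P₀ * R' := le_add_of_nonneg_left (mul_nonneg hP' hR₀)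
  have hG₁ : w₂ * w₃ ≤ w₂ * w₃ + w₁ * w₃ + w₁ * w₂ := by nlinarith [mul_nonneg nw₁ nw₃, mul_nonneg nw₁ nw₂]
  have hG₂ : w₁ * w₃ ≤ w₂ * w₃ + w₁ * w₃ + w₁ * w₂ := by nlinarith [mul_nonneg nw₂ nw₃, mul_nonneg nw₁ nw₂]
  have hG₃ : w₁ * w₂ ≤ w₂ * w₃ + w₁ * w₃ + w₁ * w₂ := by nlinarith [mul_nonneg nw₂ nw₃, mul_nonneg nw₁ nw₃]
  have hG : 0 ≤ w₂ * w₃ + w₁ * w₃ + w₁ * w₂ := by positivity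
  have hwk1 : wk ≤ C₂ * wk := by nlinarith
  -- the four terms
  have T1 : |pa * qab * rb| ≤ C₂ * wk * (Q₀ * (P' * R₀ + P₀ * R')) * (w₂ * w₃ + w₁ * w₃ + w₁ * w₂) := by
    rcases hres with h | h
    · have h1 : |pa| ≤ P' * (C₂ * wk) := hpa'.trans (by gcongr)
      calc |pa * qab * rb| ≤ P' * (C₂ * wk) * (Q₀ * w₂) * (R₀ * w₃) := abs_mul_three_le h1 hqab hrb₀
        _ = C₂ * wk * (Q₀ * (P' * R₀)) * (w₂ * w₃) := by ring
        _ ≤ C₂ * wk * (Q₀ * (P' * R₀ + P₀ * R')) * (w₂ * w₃ + w₁ * w₃ + w₁ * w₂) := by gcongr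
    · have h3 : |rb| ≤ R' * (C₂ * wk) := hrb'.trans (by gcongr)
      calc |pa * qab * rb| ≤ P₀ * w₁ * (Q₀ * w₂) * (R' * (C₂ * wk)) := abs_mul_three_le hpa₀ hqab h3
        _ = C₂ * wk * (Q₀ * (P₀ * R')) * (w₁ * w₂) := by ring
        _ ≤ C₂ * wk * (Q₀ * (P' * R₀ + P₀ * R')) * (w₂ * w₃ + w₁ * w₃ + w₁ * w₂) := by gcongr
  have T2 : |pk * qab * rb| ≤ C₂ * wk * (Q₀ * (P' * R₀ + P₀ * R')) * (w₂ * w₃ + w₁ * w₃ + w₁ * w₂) := by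
    calc |pk * qab * rb| ≤ P' * wk * (Q₀ * w₂) * (R₀ * w₃) := abs_mul_three_le hpk hqab hrb₀
      _ = wk * (Q₀ * (P' * R₀)) * (w₂ * w₃) := by ring
      _ ≤ C₂ * wk * (Q₀ * (P' * R₀ + P₀ * R')) * (w₂ * w₃ + w₁ * w₃ + w₁ * w₂) := by gcongr
  have T3 : |pk * qa * rb| ≤ C₂ * wk * (Q₀ * (P' * R₀ + P₀ * R')) * (w₂ * w₃ + w₁ * w₃ + w₁ * w₂) := by
    calc |pk * qa * rb| ≤ P' * wk * (Q₀ * w₁) * (R₀ * w₃) := abs_mul_three_le hpk hqa hrb₀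
      _ = wk * (Q₀ * (P' * R₀)) * (w₁ * w₃) := by ring
      _ ≤ C₂ * wk * (Q₀ * (P' * R₀ + P₀ * R')) * (w₂ * w₃ + w₁ * w₃ + w₁ * w₂) := by gcongr
  have T4 : |pk * qa * rab| ≤ C₂ * wk * (Q₀ * (P' * R₀ + P₀ * R')) * (w₂ * w₃ + w₁ * w₃ + w₁ * w₂) := by
    calc |pk * qa * rab| ≤ P' * wk * (Q₀ * w₁) * (R₀ * w₂) := abs_mul_three_le hpk hqa hrab
      _ = wk * (Q₀ * (P' * R₀)) * (w₁ * w₂) := by ring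
      _ ≤ C₂ * wk * (Q₀ * (P' * R₀ + P₀ * R')) * (w₂ * w₃ + w₁ * w₃ + w₁ * w₂) := by gcongr
  calc |pa * qab * rb - pk * qab * rb + pk * qa * rb - pk * qa * rab|
      ≤ |pa * qab * rb - pk * qab * rb + pk * qa * rb| + |pk * qa * rab| := abs_sub _ _
    _ ≤ |pa * qab * rb - pk * qab * rb| + |pk * qa * rb| + |pk * qa * rab| := by
        gcongr; exact abs_add_le _ _
    _ ≤ |pa * qab * rb| + |pk * qab * rb| + |pk * qa * rb| + |pk * qa * rab| := by
        gcongr; exact abs_sub _ _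
    _ ≤ 4 * C₂ * wk * (Q₀ * (P' * R₀ + P₀ * R')) * (w₂ * w₃ + w₁ * w₃ + w₁ * w₂) := by
        linarith

end Domination

section SubspaceIntegrals

variable {E : Type*} [NormedAddCommGroup E] [InnerProductSpace ℝ E] [FiniteDimensional ℝ E]
  [MeasurableSpace E] [BorelSpace E]

/-- **Uniform bound for subspace integrals of the weight.** For `σ > dim E` there is `C` such that
for every linear subspace `V ≤ E` (with its induced volume) and every `c ∈ E`,
`b ↦ (1 + ‖c + b‖)^{-σ}` is integrable on `V` with integral at most `C`. Proof: Pythagoras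
reduces to `c ∈ V`, translation invariance to `c = 0`, and an isometry to `ℝ^{dim V}`. [folklore] -/
theorem exists_subspace_integral_le {σ : ℝ} (hσ : (Module.finrank ℝ E : ℝ) < σ) :
    ∃ C : ℝ, 0 ≤ C ∧ ∀ (V : Submodule ℝ E) (c : E),
      Integrable (fun b : V => (1 + ‖c + (b : E)‖) ^ (-σ)) ∧
      ∫ b : V, (1 + ‖c + (b : E)‖) ^ (-σ) ≤ C := by
  set J : ℕ → ℝ := fun m => ∫ x : EuclideanSpace ℝ (Fin m), (1 + ‖x‖) ^ (-σ) with hJ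
  have hJ0 : ∀ m, 0 ≤ J m := fun m => integral_nonneg fun x => (wt_pos σ x).le
  refine ⟨∑ m ∈ Finset.range (Module.finrank ℝ E + 1), J m,
    Finset.sum_nonneg fun m _ => hJ0 m, ?_⟩
  intro V c
  have hσ0 : 0 ≤ σ := le_trans (Nat.cast_nonneg _) hσ.le
  have hVle : Module.finrank ℝ V ≤ Module.finrank ℝ E := Submodule.finrank_le V
  have hσV : (Module.finrank ℝ V : ℝ) < σ := lt_of_le_of_lt (by exact_mod_cast hVle) hσ
  have hint0 : Integrable (fun b : V => (1 + ‖b‖) ^ (-σ)) (volume : Measure V) :=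
    integrable_one_add_norm hσV
  have hval : ∫ b : V, (1 + ‖b‖) ^ (-σ) = J (Module.finrank ℝ V) := by
    simp only [hJ]
    have hφ := (stdOrthonormalBasis ℝ V).repr.measurePreserving
    rw [← hφ.integral_comp (stdOrthonormalBasis ℝ V).repr.toHomeomorph.measurableEmbedding]
    simp only [LinearIsometryEquiv.norm_map]
  -- Pythagoras: reduce `c` to its projection onto `V`
  set c' : E := V.starProjection c with hc'
  have hc'mem : c' ∈ V := V.starProjection_apply_mem c
  set cV : V := ⟨c', hc'mem⟩ with hcV
  have hpyth : ∀ b : V, ‖cV + b‖ ≤ ‖c + (b : E)‖ := by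
    intro b
    have h1 : c - c' ∈ Vᗮ := V.sub_starProjection_mem_orthogonal c
    have h2 : c' + (b : E) ∈ V := V.add_mem hc'mem b.2
    have horth : ⟪c - c', c' + (b : E)⟫_ℝ = 0 := Submodule.inner_left_of_mem_orthogonal h2 h1
    have hdec : c + (b : E) = (c - c') + (c' + b) := by abel
    have hsq : ‖c' + (b : E)‖ ^ 2 ≤ ‖c + (b : E)‖ ^ 2 := by
      have := norm_add_sq_eq_norm_sq_add_norm_sq_real horth
      rw [hdec]
      nlinarith [this, sq_nonneg ‖c - c'‖]
    have hnorm : ‖cV + b‖ = ‖c' + (b : E)‖ := rfl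
    rw [hnorm]
    exact le_of_pow_le_pow_left₀ two_ne_zero (norm_nonneg _) hsq
  have hwt : ∀ b : V, (1 + ‖c + (b : E)‖) ^ (-σ) ≤ (1 + ‖cV + b‖) ^ (-σ) := fun b =>
    Real.rpow_le_rpow_of_nonpos (by positivity) (by linarith [hpyth b]) (by linarith)
  have hint1 : Integrable (fun b : V => (1 + ‖cV + b‖) ^ (-σ)) (volume : Measure V) :=
    hint0.comp_add_left cV
  have htrans : ∫ b : V, (1 + ‖cV + b‖) ^ (-σ) = ∫ b : V, (1 + ‖b‖) ^ (-σ) :=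
    integral_add_left_eq_self (fun b : V => (1 + ‖b‖) ^ (-σ)) cV
  have hmeas : AEStronglyMeasurable (fun b : V => (1 + ‖c + (b : E)‖) ^ (-σ))
      (volume : Measure V) :=
    (by fun_prop : Measurable fun b : V => (1 + ‖c + (b : E)‖) ^ (-σ)).aestronglyMeasurable
  have hintc : Integrable (fun b : V => (1 + ‖c + (b : E)‖) ^ (-σ)) (volume : Measure V) := by
    refine hint1.mono' hmeas (Eventually.of_forall fun b => ?_)
    rw [Real.norm_of_nonneg (wt_pos σ _).le]
    exact hwt b
  refine ⟨hintc, ?_⟩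
  calc ∫ b : V, (1 + ‖c + (b : E)‖) ^ (-σ) ≤ ∫ b : V, (1 + ‖cV + b‖) ^ (-σ) :=
        integral_mono hintc hint1 hwt
    _ = J (Module.finrank ℝ V) := by rw [htrans, hval]
    _ ≤ ∑ m ∈ Finset.range (Module.finrank ℝ E + 1), J m :=
        Finset.single_le_sum (f := J) (fun i _ => hJ0 i)
          (Finset.mem_range.mpr (Nat.lt_succ_of_le hVle))

end SubspaceIntegrals

section Radial

variable {E : Type*} [NormedAddCommGroup E] [InnerProductSpace ℝ E] [FiniteDimensional ℝ E]
  [MeasurableSpace E] [BorelSpace E]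

/-- `a ↦ ‖a‖⁻¹` is integrable on the unit ball as soon as `dim E ≥ 2` (polar coordinates:
`r^{d-1} · r⁻¹ = r^{d-2}` is bounded on `(0,1)`). [folklore] -/
theorem integrableOn_norm_inv_ball (hE : 2 ≤ Module.finrank ℝ E) :
    IntegrableOn (fun a : E => ‖a‖⁻¹) (ball (0 : E) 1) := by
  have : Nontrivial E := Module.nontrivial_of_finrank_pos (R := ℝ) (by omega)
  have h : EqOn (fun y : ℝ => y ^ (Module.finrank ℝ E - 2))
      (fun y : ℝ => y ^ (Module.finrank ℝ E - 1) • (fun y : ℝ => y⁻¹) y) (Ioo (0 : ℝ) 1) := by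
    intro y hy
    have hy0 : (y : ℝ) ≠ 0 := hy.1.ne'
    simp only [smul_eq_mul]
    obtain ⟨m, hm⟩ : ∃ m, Module.finrank ℝ E - 1 = m + 1 := ⟨Module.finrank ℝ E - 2, by omega⟩
    rw [hm, pow_succ, mul_assoc, mul_inv_cancel₀ hy0, mul_one]
    congr 1; omega
  have key : IntegrableOn (fun y : ℝ => y ^ (Module.finrank ℝ E - 1) • (fun y : ℝ => y⁻¹) y)
      (Ioo (0 : ℝ) 1) :=
    ((continuous_pow _).integrableOn_Icc.mono_set Ioo_subset_Icc_self).congr_fun h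
      measurableSet_Ioo
  exact (integrableOn_fun_norm_addHaar (volume : Measure E)).mpr key

/-- **Outer integral bound.** With `h_k(a) = 2·2^σ (1 + ‖a‖)^{-σ} + (1 + ‖k + a‖)^{-σ}` (the
hyperplane integral of the dominating function, up to the constant of
`exists_subspace_integral_le`), `a ↦ ‖a‖⁻¹ h_k(a)` is integrable on `E` with integral bounded
uniformly in `k` (`dim E ≥ 2`, `σ > dim E`). [folklore] -/
theorem exists_outer_integral_le {σ : ℝ} (hσ : (Module.finrank ℝ E : ℝ) < σ)
    (hE : 2 ≤ Module.finrank ℝ E) :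
    ∃ M : ℝ, ∀ k : E,
      Integrable (fun a : E =>
        ‖a‖⁻¹ * (2 * (2 : ℝ) ^ σ * (1 + ‖a‖) ^ (-σ) + (1 + ‖k + a‖) ^ (-σ))) ∧
      ∫ a, ‖a‖⁻¹ * (2 * (2 : ℝ) ^ σ * (1 + ‖a‖) ^ (-σ) + (1 + ‖k + a‖) ^ (-σ)) ≤ M := by
  have hσ0 : 0 ≤ σ := le_trans (Nat.cast_nonneg _) hσ.le
  set K₁ : ℝ := 2 * (2 : ℝ) ^ σ + 1 with hK₁
  set L : ℝ := ∫ a in ball (0 : E) 1, ‖a‖⁻¹ with hL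
  set Jσ : ℝ := ∫ a : E, (1 + ‖a‖) ^ (-σ) with hJσ
  have hJ : Integrable (fun a : E => (1 + ‖a‖) ^ (-σ)) := integrable_one_add_norm hσ
  have hLint : IntegrableOn (fun a : E => ‖a‖⁻¹) (ball (0 : E) 1) := integrableOn_norm_inv_ball hE
  refine ⟨K₁ * L + (2 * 2 ^ σ * Jσ + Jσ), fun k => ?_⟩
  have hJk : Integrable (fun a : E => (1 + ‖k + a‖) ^ (-σ)) := hJ.comp_add_left k
  have hh : Integrable (fun a : E =>
      2 * (2 : ℝ) ^ σ * (1 + ‖a‖) ^ (-σ) + (1 + ‖k + a‖) ^ (-σ)) := (hJ.const_mul _).add hJk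
  have hD : Integrable (fun a : E => K₁ * (ball (0 : E) 1).indicator (fun a => ‖a‖⁻¹) a
      + (2 * (2 : ℝ) ^ σ * (1 + ‖a‖) ^ (-σ) + (1 + ‖k + a‖) ^ (-σ))) :=
    ((hLint.integrable_indicator measurableSet_ball).const_mul K₁).add hh
  have hle : ∀ a : E, ‖a‖⁻¹ * (2 * (2 : ℝ) ^ σ * (1 + ‖a‖) ^ (-σ) + (1 + ‖k + a‖) ^ (-σ)) ≤
      K₁ * (ball (0 : E) 1).indicator (fun a => ‖a‖⁻¹) a
        + (2 * (2 : ℝ) ^ σ * (1 + ‖a‖) ^ (-σ) + (1 + ‖k + a‖) ^ (-σ)) := by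
    intro a
    have hh0 : 0 ≤ 2 * (2 : ℝ) ^ σ * (1 + ‖a‖) ^ (-σ) + (1 + ‖k + a‖) ^ (-σ) := by positivity
    have hhK : 2 * (2 : ℝ) ^ σ * (1 + ‖a‖) ^ (-σ) + (1 + ‖k + a‖) ^ (-σ) ≤ K₁ := by
      have e1 : 2 * (2 : ℝ) ^ σ * (1 + ‖a‖) ^ (-σ) ≤ 2 * 2 ^ σ * 1 := by
        gcongr; exact wt_le_one hσ0 a
      have e2 := wt_le_one hσ0 (k + a)
      simp only [hK₁]; linarith
    by_cases ha : a ∈ ball (0 : E) 1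
    · rw [indicator_of_mem ha]
      calc ‖a‖⁻¹ * (2 * (2 : ℝ) ^ σ * (1 + ‖a‖) ^ (-σ) + (1 + ‖k + a‖) ^ (-σ))
          ≤ ‖a‖⁻¹ * K₁ := by gcongr
        _ = K₁ * ‖a‖⁻¹ := mul_comm _ _
        _ ≤ K₁ * ‖a‖⁻¹ + _ := le_add_of_nonneg_right hh0
    · rw [indicator_of_notMem ha, mul_zero, zero_add]
      have ha1 : 1 ≤ ‖a‖ := by simpa [mem_ball_zero_iff] using ha
      have : ‖a‖⁻¹ ≤ 1 := inv_le_one_of_one_le₀ ha1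
      calc ‖a‖⁻¹ * (2 * (2 : ℝ) ^ σ * (1 + ‖a‖) ^ (-σ) + (1 + ‖k + a‖) ^ (-σ))
          ≤ 1 * (2 * (2 : ℝ) ^ σ * (1 + ‖a‖) ^ (-σ) + (1 + ‖k + a‖) ^ (-σ)) := by gcongr
        _ = _ := one_mul _
  have hmeas : AEStronglyMeasurable (fun a : E =>
      ‖a‖⁻¹ * (2 * (2 : ℝ) ^ σ * (1 + ‖a‖) ^ (-σ) + (1 + ‖k + a‖) ^ (-σ))) volume :=
    (by fun_prop : Measurable fun a : E =>
      ‖a‖⁻¹ * (2 * (2 : ℝ) ^ σ * (1 + ‖a‖) ^ (-σ) + (1 + ‖k + a‖) ^ (-σ))).aestronglyMeasurable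
  have hnn : ∀ a : E,
      0 ≤ ‖a‖⁻¹ * (2 * (2 : ℝ) ^ σ * (1 + ‖a‖) ^ (-σ) + (1 + ‖k + a‖) ^ (-σ)) := fun a => by
    positivity
  have hint : Integrable (fun a : E =>
      ‖a‖⁻¹ * (2 * (2 : ℝ) ^ σ * (1 + ‖a‖) ^ (-σ) + (1 + ‖k + a‖) ^ (-σ))) :=
    hD.mono' hmeas (Eventually.of_forall fun a => by
      rw [Real.norm_of_nonneg (hnn a)]; exact hle a)
  refine ⟨hint, ?_⟩
  calc ∫ a, ‖a‖⁻¹ * (2 * (2 : ℝ) ^ σ * (1 + ‖a‖) ^ (-σ) + (1 + ‖k + a‖) ^ (-σ))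
      ≤ ∫ a, (K₁ * (ball (0 : E) 1).indicator (fun a => ‖a‖⁻¹) a
          + (2 * (2 : ℝ) ^ σ * (1 + ‖a‖) ^ (-σ) + (1 + ‖k + a‖) ^ (-σ))) :=
        integral_mono hint hD hle
    _ = K₁ * L + (2 * 2 ^ σ * Jσ + Jσ) := by
        rw [integral_add ((hLint.integrable_indicator measurableSet_ball).const_mul K₁) hh,
          integral_const_mul, integral_indicator measurableSet_ball,
          integral_add (hJ.const_mul _) hJk, integral_const_mul,
          integral_add_left_eq_self (fun a : E => (1 + ‖a‖) ^ (-σ)) k]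

end Radial

section Householder

variable {E : Type*} [NormedAddCommGroup E] [InnerProductSpace ℝ E]

/-- **Householder isometry between hyperplanes.** For a unit vector `e` and `a ≠ 0`, the
reflection in the hyperplane orthogonal to `e − a/‖a‖` maps `e ↦ a/‖a‖` and restricts to a
linear isometry `(ℝ ∙ e)ᗮ ≃ₗᵢ (ℝ ∙ a)ᗮ`. [folklore] -/
theorem exists_hyperplane_isometry {e : E} (he : ‖e‖ = 1) {a : E} (ha : a ≠ 0) :
    ∃ S : ↥(ℝ ∙ e)ᗮ ≃ₗᵢ[ℝ] ↥(ℝ ∙ a)ᗮ,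
      ∀ x : ↥(ℝ ∙ e)ᗮ, (S x : E) = ((ℝ ∙ (e - ‖a‖⁻¹ • a))ᗮ).reflection x := by
  set u : E := ‖a‖⁻¹ • a with hu
  have hu1 : ‖u‖ = 1 := norm_smul_inv_norm ha
  set R := ((ℝ ∙ (e - u))ᗮ).reflection with hR
  have hRe : R e = u := Submodule.reflection_sub (by rw [he, hu1])
  have hRu : R u = e := by
    have h := congrArg R hRe
    rw [Submodule.reflection_reflection] at h
    exact h.symm
  have hau : a = ‖a‖ • u := by
    rw [hu, smul_smul, mul_inv_cancel₀ (norm_ne_zero_iff.mpr ha), one_smul]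
  have hmap : ((ℝ ∙ e)ᗮ).map (R.toLinearEquiv : E →ₗ[ℝ] E) = (ℝ ∙ a)ᗮ := by
    ext y
    simp only [Submodule.mem_map, Submodule.mem_orthogonal_singleton_iff_inner_right]
    constructor
    · rintro ⟨x, hx, rfl⟩
      have h1 : ⟪u, R x⟫_ℝ = ⟪e, x⟫_ℝ := by rw [← hRe]; exact R.inner_map_map e x
      change ⟪a, R x⟫_ℝ = 0
      rw [hau, real_inner_smul_left, h1, hx, mul_zero]
    · intro hy
      refine ⟨R y, ?_, ?_⟩
      · have h1 : ⟪e, R y⟫_ℝ = ⟪u, y⟫_ℝ := by rw [← hRu]; exact R.inner_map_map u y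
        rw [h1, hu, real_inner_smul_left, hy, mul_zero]
      · change R (R y) = y
        exact Submodule.reflection_reflection _ _
  refine ⟨(R.submoduleMap (ℝ ∙ e)ᗮ).trans (LinearIsometryEquiv.ofEq _ _ hmap), fun x => ?_⟩
  rfl

variable [FiniteDimensional ℝ E] [MeasurableSpace E] [BorelSpace E]

/-- The Householder reflections `x ↦ R_a x` (reflection in `(ℝ ∙ (e − a/‖a‖))ᗮ`) depend
measurably on `(a, x)`; explicit formula `R_a x = x − 2 (⟪v, x⟫ / ‖v‖²) v`, `v = e − a/‖a‖`.
[folklore] -/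
theorem measurable_householder {α : Type*} [MeasurableSpace α] (e : E) {f g : α → E}
    (hf : Measurable f) (hg : Measurable g) :
    Measurable (fun x => ((ℝ ∙ (e - ‖f x‖⁻¹ • f x))ᗮ).reflection (g x)) := by
  have hform : (fun x => ((ℝ ∙ (e - ‖f x‖⁻¹ • f x))ᗮ).reflection (g x)) =
      fun x => g x - (2 * (⟪e - ‖f x‖⁻¹ • f x, g x⟫_ℝ / ‖e - ‖f x‖⁻¹ • f x‖ ^ 2)) •
        (e - ‖f x‖⁻¹ • f x) := by
    funext x
    rw [Submodule.reflection_orthogonal_apply, Submodule.reflection_singleton_apply]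
    simp only [RCLike.ofReal_real_eq_id, id_eq, two_smul, neg_sub, mul_smul]
  rw [hform]
  fun_prop

/-- **Measurability in the normal direction of hyperplane integrals.** For a jointly measurable
`Ψ : E → E → ℝ`, the hyperplane integrals `a ↦ ∫_{(ℝ ∙ a)ᗮ} Ψ a b db` (volume induced by the
inner product) form an a.e.-strongly measurable function of `a` (reparametrise `(ℝ ∙ a)ᗮ` by a
fixed hyperplane through Householder reflections, which are measure preserving). [folklore] -/
theorem aestronglyMeasurable_integral_orthogonal (hE : 0 < Module.finrank ℝ E) {Ψ : E → E → ℝ}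
    (hΨ : Measurable (Function.uncurry Ψ)) :
    AEStronglyMeasurable (fun a : E => ∫ b : ↥(ℝ ∙ a)ᗮ, Ψ a b) volume := by
  have : Nontrivial E := Module.nontrivial_of_finrank_pos (R := ℝ) hE
  obtain ⟨e, he⟩ : ∃ e : E, ‖e‖ = 1 := exists_norm_eq E zero_le_one
  set F : E × ↥(ℝ ∙ e)ᗮ → ℝ :=
    fun p => Ψ p.1 (((ℝ ∙ (e - ‖p.1‖⁻¹ • p.1))ᗮ).reflection (p.2 : E)) with hF
  have hFm : Measurable F := by
    have h1 : Measurable (fun p : E × ↥(ℝ ∙ e)ᗮ =>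
        (p.1, ((ℝ ∙ (e - ‖p.1‖⁻¹ • p.1))ᗮ).reflection (p.2 : E))) :=
      measurable_fst.prodMk (measurable_householder e measurable_fst
        (measurable_subtype_coe.comp measurable_snd))
    exact hΨ.comp h1
  have hG : StronglyMeasurable (fun a : E => ∫ x : ↥(ℝ ∙ e)ᗮ, F (a, x)) :=
    hFm.stronglyMeasurable.integral_prod_right'
  refine hG.aestronglyMeasurable.congr ?_
  have h0 : ∀ᵐ a ∂(volume : Measure E), a ≠ 0 := by
    rw [ae_iff]
    have : {a : E | ¬a ≠ 0} = {0} := by ext a; simp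
    rw [this]
    exact measure_singleton 0
  filter_upwards [h0] with a ha
  obtain ⟨S, hS⟩ := exists_hyperplane_isometry he ha
  have hcomp := S.measurePreserving.integral_comp S.toHomeomorph.measurableEmbedding
    (fun b : ↥(ℝ ∙ a)ᗮ => Ψ a b)
  simp only [hF]
  rw [← hcomp]
  congr 1
  funext x
  rw [← hS x]

end Householder

section Core

variable {E : Type*} [NormedAddCommGroup E] [InnerProductSpace ℝ E] [FiniteDimensional ℝ E]
  [MeasurableSpace E] [BorelSpace E]

/-- **Core iterated-integral bound.** For `σ > dim E`, `dim E ≥ 2`, there is `A ≥ 0` such that for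
every jointly measurable `Ψ : E → E → ℝ` dominated on the resonant manifold by `K` times the
geometric weight `G(k,a,b)` of `cubic_dom` (exponent `s₀ = 2σ`): each hyperplane integral
`∫_{(ℝ ∙ a)ᗮ} Ψ a` converges absolutely, the outer integrand `a ↦ (2‖a‖)⁻¹ ∫_{(ℝ ∙ a)ᗮ} Ψ a` is
integrable, and the iterated integral is bounded by `K · A`. [folklore] -/
theorem exists_core_bound {σ : ℝ} (hσ : (Module.finrank ℝ E : ℝ) < σ)
    (hE : 2 ≤ Module.finrank ℝ E) :
    ∃ A₁ A : ℝ, 0 ≤ A₁ ∧ 0 ≤ A ∧ ∀ (Ψ : E → E → ℝ) (K : ℝ) (k : E), 0 ≤ K →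
      Measurable (Function.uncurry Ψ) →
      (∀ a b : E, ⟪a, b⟫_ℝ = 0 → |Ψ a b| ≤ K *
        ((1 + ‖k + a + b‖) ^ (-(2 * σ)) * (1 + ‖k + b‖) ^ (-(2 * σ))
          + (1 + ‖k + a‖) ^ (-(2 * σ)) * (1 + ‖k + b‖) ^ (-(2 * σ))
          + (1 + ‖k + a‖) ^ (-(2 * σ)) * (1 + ‖k + a + b‖) ^ (-(2 * σ)))) →
      (∀ a : E, Integrable (fun b : ↥(ℝ ∙ a)ᗮ => Ψ a b)) ∧
      (∀ a : E, |∫ b : ↥(ℝ ∙ a)ᗮ, Ψ a b| ≤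
        K * A₁ * (2 * (2 : ℝ) ^ σ * (1 + ‖a‖) ^ (-σ) + (1 + ‖k + a‖) ^ (-σ))) ∧
      Integrable (fun a : E => (2 * ‖a‖)⁻¹ * ∫ b : ↥(ℝ ∙ a)ᗮ, Ψ a b) ∧
      |∫ a : E, (2 * ‖a‖)⁻¹ * ∫ b : ↥(ℝ ∙ a)ᗮ, Ψ a b| ≤ K * A := by
  have hσ0 : 0 ≤ σ := le_trans (Nat.cast_nonneg _) hσ.le
  have hE0 : 0 < Module.finrank ℝ E := by omega
  obtain ⟨C, hC0, hC⟩ := exists_subspace_integral_le (E := E) hσ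
  obtain ⟨M, hM⟩ := exists_outer_integral_le (E := E) hσ hE
  have hM0 : 0 ≤ M := le_trans (integral_nonneg fun a => by positivity) (hM 0).2
  refine ⟨C, C * M / 2, hC0, by positivity, ?_⟩
  intro Ψ K k hK hΨ hdom
  -- the hyperplane-integrable dominating function
  set H : E → E → ℝ := fun a b => 2 * (2 : ℝ) ^ σ * (1 + ‖a‖) ^ (-σ) * (1 + ‖k + b‖) ^ (-σ)
      + (1 + ‖k + a‖) ^ (-σ) * (1 + ‖k + a + b‖) ^ (-σ) with hH
  set h : E → ℝ := fun a => 2 * (2 : ℝ) ^ σ * (1 + ‖a‖) ^ (-σ) + (1 + ‖k + a‖) ^ (-σ) with hh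
  have hdomH : ∀ a b : E, ⟪a, b⟫_ℝ = 0 → |Ψ a b| ≤ K * H a b := fun a b hab =>
    (hdom a b hab).trans (mul_le_mul_of_nonneg_left (resonant_weights_le hσ0 k a b hab) hK)
  -- inner integrals
  have hHint : ∀ a : E, Integrable (fun b : ↥(ℝ ∙ a)ᗮ => H a b) ∧
      ∫ b : ↥(ℝ ∙ a)ᗮ, H a b ≤ C * h a := by
    intro a
    have i1 := hC (ℝ ∙ a)ᗮ k
    have i2 := hC (ℝ ∙ a)ᗮ (k + a)
    refine ⟨(i1.1.const_mul _).add (i2.1.const_mul _), ?_⟩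
    rw [integral_add (i1.1.const_mul _) (i2.1.const_mul _), integral_const_mul,
      integral_const_mul]
    have e1 : 2 * (2 : ℝ) ^ σ * (1 + ‖a‖) ^ (-σ) * ∫ b : ↥(ℝ ∙ a)ᗮ, (1 + ‖k + (b : E)‖) ^ (-σ)
        ≤ 2 * (2 : ℝ) ^ σ * (1 + ‖a‖) ^ (-σ) * C := by gcongr; exact i1.2
    have e2 : (1 + ‖k + a‖) ^ (-σ) * ∫ b : ↥(ℝ ∙ a)ᗮ, (1 + ‖k + a + (b : E)‖) ^ (-σ)
        ≤ (1 + ‖k + a‖) ^ (-σ) * C := by gcongr; exact i2.2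
    simp only [hh]
    linarith
  have hinner : ∀ a : E, Integrable (fun b : ↥(ℝ ∙ a)ᗮ => Ψ a b) ∧
      |∫ b : ↥(ℝ ∙ a)ᗮ, Ψ a b| ≤ K * (C * h a) := by
    intro a
    have hmeas : Measurable (fun b : ↥(ℝ ∙ a)ᗮ => Ψ a b) :=
      hΨ.comp (measurable_const.prodMk measurable_subtype_coe)
    have hb : ∀ b : ↥(ℝ ∙ a)ᗮ, ‖Ψ a b‖ ≤ K * H a b := fun b => by
      rw [Real.norm_eq_abs]
      exact hdomH a b ((Submodule.mem_orthogonal_singleton_iff_inner_right).mp b.2)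
    have hint : Integrable (fun b : ↥(ℝ ∙ a)ᗮ => Ψ a b) :=
      ((hHint a).1.const_mul K).mono' hmeas.aestronglyMeasurable (Eventually.of_forall hb)
    refine ⟨hint, ?_⟩
    calc |∫ b : ↥(ℝ ∙ a)ᗮ, Ψ a b| = ‖∫ b : ↥(ℝ ∙ a)ᗮ, Ψ a b‖ := (Real.norm_eq_abs _).symm
      _ ≤ ∫ b : ↥(ℝ ∙ a)ᗮ, K * H a b :=
          norm_integral_le_of_norm_le ((hHint a).1.const_mul K) (Eventually.of_forall hb)
      _ = K * ∫ b : ↥(ℝ ∙ a)ᗮ, H a b := integral_const_mul _ _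
      _ ≤ K * (C * h a) := mul_le_mul_of_nonneg_left (hHint a).2 hK
  refine ⟨fun a => (hinner a).1, fun a => by rw [mul_assoc]; exact (hinner a).2, ?_⟩
  -- outer integral
  have hmeasO : AEStronglyMeasurable (fun a : E => (2 * ‖a‖)⁻¹ * ∫ b : ↥(ℝ ∙ a)ᗮ, Ψ a b)
      volume :=
    ((measurable_const.mul measurable_norm).inv.aestronglyMeasurable).mul
      (aestronglyMeasurable_integral_orthogonal hE0 hΨ)
  have hbO : ∀ a : E, ‖(2 * ‖a‖)⁻¹ * ∫ b : ↥(ℝ ∙ a)ᗮ, Ψ a b‖ ≤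
      K * C / 2 * (‖a‖⁻¹ * h a) := by
    intro a
    rw [norm_mul, Real.norm_eq_abs, Real.norm_eq_abs, abs_of_nonneg (by positivity)]
    calc (2 * ‖a‖)⁻¹ * |∫ b : ↥(ℝ ∙ a)ᗮ, Ψ a b| ≤ (2 * ‖a‖)⁻¹ * (K * (C * h a)) := by
          gcongr; exact (hinner a).2
      _ = K * C / 2 * (‖a‖⁻¹ * h a) := by rw [mul_inv]; ring
  have hintO : Integrable (fun a : E => (2 * ‖a‖)⁻¹ * ∫ b : ↥(ℝ ∙ a)ᗮ, Ψ a b) :=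
    (((hM k).1).const_mul (K * C / 2)).mono' hmeasO (Eventually.of_forall hbO)
  refine ⟨hintO, ?_⟩
  calc |∫ a : E, (2 * ‖a‖)⁻¹ * ∫ b : ↥(ℝ ∙ a)ᗮ, Ψ a b|
      = ‖∫ a : E, (2 * ‖a‖)⁻¹ * ∫ b : ↥(ℝ ∙ a)ᗮ, Ψ a b‖ := (Real.norm_eq_abs _).symm
    _ ≤ ∫ a : E, K * C / 2 * (‖a‖⁻¹ * h a) :=
        norm_integral_le_of_norm_le (((hM k).1).const_mul (K * C / 2)) (Eventually.of_forall hbO)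
    _ = K * C / 2 * ∫ a : E, ‖a‖⁻¹ * h a := integral_const_mul _ _
    _ ≤ K * C / 2 * M := by gcongr; exact (hM k).2
    _ = K * (C * M / 2) := by ring

end Core

section CollisionBounds

variable {E : Type*} [NormedAddCommGroup E] [InnerProductSpace ℝ E] [FiniteDimensional ℝ E]
  [MeasurableSpace E] [BorelSpace E]

/-- Joint measurability in `(a, b)` of the resonant cubic integrand for measurable `n`.
[folklore] -/
theorem measurable_cubicForm_uncurry {n : E → ℝ} (hn : Measurable n) (k : E) :
    Measurable (Function.uncurry fun a b : E => cubicForm n k (k + a) (k + a + b) (k + b)) := by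
  have h : (Function.uncurry fun a b : E => cubicForm n k (k + a) (k + a + b) (k + b)) =
      fun p : E × E => n (k + p.1) * n (k + p.1 + p.2) * n (k + p.2)
        - n k * n (k + p.1 + p.2) * n (k + p.2) + n k * n (k + p.1) * n (k + p.2)
        - n k * n (k + p.1) * n (k + p.1 + p.2) := rfl
  rw [h]
  fun_prop

omit [FiniteDimensional ℝ E] [MeasurableSpace E] [BorelSpace E] in
/-- Pointwise domination of the **difference** of two cubic integrands on the resonant manifold:
if `|n|, |m| ≤ N₀ w₀` and `|n − m| ≤ D w₀` (`w₀ = (1 + ‖·‖)^{-s₀}`), then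
`|cubicForm n − cubicForm m| ≤ 24 · 2^{s₀} w₀(k) N₀² D · G` (trilinear telescoping plus
`cubic_dom`). [folklore] -/
theorem cubic_sub_dom {s₀ : ℝ} (hs₀ : 0 ≤ s₀) {n m : E → ℝ} {N₀ D : ℝ} (hN₀ : 0 ≤ N₀)
    (hD : 0 ≤ D) (hdn : ∀ x, |n x| ≤ N₀ * (1 + ‖x‖) ^ (-s₀))
    (hdm : ∀ x, |m x| ≤ N₀ * (1 + ‖x‖) ^ (-s₀))
    (hdnm : ∀ x, |n x - m x| ≤ D * (1 + ‖x‖) ^ (-s₀)) (k a b : E) (hab : ⟪a, b⟫_ℝ = 0) :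
    |cubicForm n k (k + a) (k + a + b) (k + b) - cubicForm m k (k + a) (k + a + b) (k + b)| ≤
      24 * (2 : ℝ) ^ s₀ * (1 + ‖k‖) ^ (-s₀) * (N₀ ^ 2 * D) *
        ((1 + ‖k + a + b‖) ^ (-s₀) * (1 + ‖k + b‖) ^ (-s₀)
          + (1 + ‖k + a‖) ^ (-s₀) * (1 + ‖k + b‖) ^ (-s₀)
          + (1 + ‖k + a‖) ^ (-s₀) * (1 + ‖k + a + b‖) ^ (-s₀)) := by
  have b1 := cubic_dom (s₀ := s₀) (s' := s₀) (p := fun x => n x - m x) (q := n) (r := n)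
    hs₀ hD hD hN₀ hN₀ hN₀ hdnm hdnm hdn hdn hdn k a b hab
  have b2 := cubic_dom (s₀ := s₀) (s' := s₀) (p := m) (q := fun x => n x - m x) (r := n)
    hs₀ hN₀ hN₀ hD hN₀ hN₀ hdm hdm hdnm hdn hdn k a b hab
  have b3 := cubic_dom (s₀ := s₀) (s' := s₀) (p := m) (q := m) (r := fun x => n x - m x)
    hs₀ hN₀ hN₀ hN₀ hD hD hdm hdm hdm hdnm hdnm k a b hab
  have e : cubicForm n k (k + a) (k + a + b) (k + b) - cubicForm m k (k + a) (k + a + b) (k + b) =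
      ((n (k + a) - m (k + a)) * n (k + a + b) * n (k + b)
          - (n k - m k) * n (k + a + b) * n (k + b)
          + (n k - m k) * n (k + a) * n (k + b) - (n k - m k) * n (k + a) * n (k + a + b))
      + (m (k + a) * (n (k + a + b) - m (k + a + b)) * n (k + b)
          - m k * (n (k + a + b) - m (k + a + b)) * n (k + b)
          + m k * (n (k + a) - m (k + a)) * n (k + b) - m k * (n (k + a) - m (k + a)) * n (k + a + b))
      + (m (k + a) * m (k + a + b) * (n (k + b) - m (k + b))
          - m k * m (k + a + b) * (n (k + b) - m (k + b))
          + m k * m (k + a) * (n (k + b) - m (k + b)) - m k * m (k + a) * (n (k + a + b) - m (k + a + b))) := by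
    simp only [cubicForm]; ring
  rw [e]
  refine (abs_add_three _ _ _).trans ?_
  refine (add_le_add (add_le_add b1 b2) b3).trans ?_
  have hw := (wt_pos s₀ k).le
  have hG : 0 ≤ (1 + ‖k + a + b‖) ^ (-s₀) * (1 + ‖k + b‖) ^ (-s₀)
          + (1 + ‖k + a‖) ^ (-s₀) * (1 + ‖k + b‖) ^ (-s₀)
          + (1 + ‖k + a‖) ^ (-s₀) * (1 + ‖k + a + b‖) ^ (-s₀) := by positivity
  apply le_of_eq
  ring

/-- **Absolute convergence of the collision integral** (`WKEIntegrable`) for measurable spectra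
with polynomial decay of order `2σ`, `σ > dim E`, `dim E ≥ 2`: all three integrability clauses
of `WaveKinetic.WKEIntegrable n k` hold at every wave number `k` (a non-optimal-exponent form of
Germain–Ionescu–Tran's weighted `L^∞` bound). [cite: GermainIonescuTran2020, Prop 2.3] -/
theorem wkeIntegrable_of_decay {σ : ℝ} (hσ : (Module.finrank ℝ E : ℝ) < σ)
    (hE : 2 ≤ Module.finrank ℝ E) {n : E → ℝ} (hn : Measurable n) {N : ℝ} (hN : 0 ≤ N)
    (hdec : ∀ x, |n x| ≤ N * (1 + ‖x‖) ^ (-(2 * σ))) (k : E) : WKEIntegrable n k := by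
  have hσ0 : 0 ≤ σ := le_trans (Nat.cast_nonneg _) hσ.le
  obtain ⟨A₁, A, hA₁, hA, hcore⟩ := exists_core_bound (E := E) hσ hE
  set K : ℝ := 4 * (2 : ℝ) ^ (2 * σ) * (1 + ‖k‖) ^ (-(2 * σ)) * (N * (N * N + N * N)) with hK
  have hK0 : 0 ≤ K := by positivity
  have hdom : ∀ a b : E, ⟪a, b⟫_ℝ = 0 → |cubicForm n k (k + a) (k + a + b) (k + b)| ≤ K *
      ((1 + ‖k + a + b‖) ^ (-(2 * σ)) * (1 + ‖k + b‖) ^ (-(2 * σ))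
        + (1 + ‖k + a‖) ^ (-(2 * σ)) * (1 + ‖k + b‖) ^ (-(2 * σ))
        + (1 + ‖k + a‖) ^ (-(2 * σ)) * (1 + ‖k + a + b‖) ^ (-(2 * σ))) := by
    intro a b hab
    have := cubic_dom (s₀ := 2 * σ) (s' := 2 * σ) (p := n) (q := n) (r := n) (by positivity)
      hN hN hN hN hN hdec hdec hdec hdec hdec k a b hab
    simpa only [cubicForm, hK] using this
  have h1 := hcore (fun a b => cubicForm n k (k + a) (k + a + b) (k + b)) K k hK0
    (measurable_cubicForm_uncurry hn k) hdom
  have h2 := hcore (fun a b => |cubicForm n k (k + a) (k + a + b) (k + b)|) K k hK0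
    (continuous_abs.measurable.comp (measurable_cubicForm_uncurry hn k))
    (fun a b hab => by rw [abs_abs]; exact hdom a b hab)
  exact ⟨Eventually.of_forall h1.1, h2.2.2.1, h1.2.2.1⟩

/-- **Tame weighted sup-norm bound for the collision operator.** For `σ > dim E`, `dim E ≥ 2`,
there is `A ≥ 0` with: if `|n| ≤ N₀ (1 + ‖·‖)^{-2σ}` and `|n| ≤ N' (1 + ‖·‖)^{-s'}` (`s' ≥ 0`),
then `|𝒦(n)(k)| ≤ A 2^{s'} N₀² N' (1 + ‖k‖)^{-s'}`: the high-order weight appears linearly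
(the `L^∞_s` bound of Germain–Ionescu–Tran in a non-optimal range; the tame form is the
standard persistence-of-decay refinement of its proof). [cite: GermainIonescuTran2020, Prop 2.3] -/
theorem exists_collision_tame_bound {σ : ℝ} (hσ : (Module.finrank ℝ E : ℝ) < σ)
    (hE : 2 ≤ Module.finrank ℝ E) :
    ∃ A : ℝ, 0 ≤ A ∧ ∀ (n : E → ℝ) (N₀ N' s' : ℝ) (k : E), Measurable n → 0 ≤ N₀ → 0 ≤ N' →
      0 ≤ s' → (∀ x, |n x| ≤ N₀ * (1 + ‖x‖) ^ (-(2 * σ))) →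
      (∀ x, |n x| ≤ N' * (1 + ‖x‖) ^ (-s')) →
      |collision n k| ≤ A * (2 : ℝ) ^ s' * N₀ ^ 2 * N' * (1 + ‖k‖) ^ (-s') := by
  obtain ⟨A₁, A, hA₁, hA, hcore⟩ := exists_core_bound (E := E) hσ hE
  refine ⟨8 * A, by positivity, ?_⟩
  intro n N₀ N' s' k hn hN₀ hN' hs' hd₀ hd'
  set K : ℝ := 4 * (2 : ℝ) ^ s' * (1 + ‖k‖) ^ (-s') * (N₀ * (N' * N₀ + N₀ * N')) with hK
  have hK0 : 0 ≤ K := by positivity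
  have hdom : ∀ a b : E, ⟪a, b⟫_ℝ = 0 → |cubicForm n k (k + a) (k + a + b) (k + b)| ≤ K *
      ((1 + ‖k + a + b‖) ^ (-(2 * σ)) * (1 + ‖k + b‖) ^ (-(2 * σ))
        + (1 + ‖k + a‖) ^ (-(2 * σ)) * (1 + ‖k + b‖) ^ (-(2 * σ))
        + (1 + ‖k + a‖) ^ (-(2 * σ)) * (1 + ‖k + a + b‖) ^ (-(2 * σ))) := by
    intro a b hab
    have := cubic_dom (s₀ := 2 * σ) (s' := s') (p := n) (q := n) (r := n) hs'
      hN₀ hN' hN₀ hN₀ hN' hd₀ hd' hd₀ hd₀ hd' k a b hab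
    simpa only [cubicForm, hK] using this
  have h := hcore (fun a b => cubicForm n k (k + a) (k + a + b) (k + b)) K k hK0
    (measurable_cubicForm_uncurry hn k) hdom
  calc |collision n k| ≤ K * A := h.2.2.2
    _ = 8 * A * (2 : ℝ) ^ s' * N₀ ^ 2 * N' * (1 + ‖k‖) ^ (-s') := by simp only [hK]; ring

/-- **Weighted sup-norm Lipschitz bound for the collision operator.** For `σ > dim E`,
`dim E ≥ 2`, there is `A ≥ 0` with: if `|n|, |m| ≤ N₀ (1 + ‖·‖)^{-2σ}` and
`|n − m| ≤ D (1 + ‖·‖)^{-2σ}`, then `|𝒦(n)(k) − 𝒦(m)(k)| ≤ A N₀² D (1 + ‖k‖)^{-2σ}`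
(non-optimal-exponent form of the trilinear weighted `L^∞` estimate).
[cite: GermainIonescuTran2020, Prop 2.3] -/
theorem exists_collision_sub_bound {σ : ℝ} (hσ : (Module.finrank ℝ E : ℝ) < σ)
    (hE : 2 ≤ Module.finrank ℝ E) :
    ∃ A : ℝ, 0 ≤ A ∧ ∀ (n m : E → ℝ) (N₀ D : ℝ) (k : E), Measurable n → Measurable m →
      0 ≤ N₀ → 0 ≤ D → (∀ x, |n x| ≤ N₀ * (1 + ‖x‖) ^ (-(2 * σ))) →
      (∀ x, |m x| ≤ N₀ * (1 + ‖x‖) ^ (-(2 * σ))) →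
      (∀ x, |n x - m x| ≤ D * (1 + ‖x‖) ^ (-(2 * σ))) →
      |collision n k - collision m k| ≤ A * N₀ ^ 2 * D * (1 + ‖k‖) ^ (-(2 * σ)) := by
  have hσ0 : 0 ≤ σ := le_trans (Nat.cast_nonneg _) hσ.le
  obtain ⟨A₁, A, hA₁, hA, hcore⟩ := exists_core_bound (E := E) hσ hE
  refine ⟨24 * (2 : ℝ) ^ (2 * σ) * A, by positivity, ?_⟩
  intro n m N₀ D k hn hm hN₀ hD hdn hdm hdnm
  have h2σ : 0 ≤ 2 * σ := by positivity
  -- individual integrands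
  set Kn : ℝ := 4 * (2 : ℝ) ^ (2 * σ) * (1 + ‖k‖) ^ (-(2 * σ)) * (N₀ * (N₀ * N₀ + N₀ * N₀))
    with hKn
  have hKn0 : 0 ≤ Kn := by positivity
  have hdom1 : ∀ (p : E → ℝ), (∀ x, |p x| ≤ N₀ * (1 + ‖x‖) ^ (-(2 * σ))) →
      ∀ a b : E, ⟪a, b⟫_ℝ = 0 → |cubicForm p k (k + a) (k + a + b) (k + b)| ≤ Kn *
      ((1 + ‖k + a + b‖) ^ (-(2 * σ)) * (1 + ‖k + b‖) ^ (-(2 * σ))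
        + (1 + ‖k + a‖) ^ (-(2 * σ)) * (1 + ‖k + b‖) ^ (-(2 * σ))
        + (1 + ‖k + a‖) ^ (-(2 * σ)) * (1 + ‖k + a + b‖) ^ (-(2 * σ))) := by
    intro p hp a b hab
    have := cubic_dom (s₀ := 2 * σ) (s' := 2 * σ) (p := p) (q := p) (r := p) h2σ
      hN₀ hN₀ hN₀ hN₀ hN₀ hp hp hp hp hp k a b hab
    simpa only [cubicForm, hKn] using this
  have hn' := hcore (fun a b => cubicForm n k (k + a) (k + a + b) (k + b)) Kn k hKn0
    (measurable_cubicForm_uncurry hn k) (hdom1 n hdn)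
  have hm' := hcore (fun a b => cubicForm m k (k + a) (k + a + b) (k + b)) Kn k hKn0
    (measurable_cubicForm_uncurry hm k) (hdom1 m hdm)
  -- the difference
  set K : ℝ := 24 * (2 : ℝ) ^ (2 * σ) * (1 + ‖k‖) ^ (-(2 * σ)) * (N₀ ^ 2 * D) with hK
  have hK0 : 0 ≤ K := by positivity
  have hd' := hcore (fun a b => cubicForm n k (k + a) (k + a + b) (k + b)
      - cubicForm m k (k + a) (k + a + b) (k + b)) K k hK0
    ((measurable_cubicForm_uncurry hn k).sub (measurable_cubicForm_uncurry hm k))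
    (fun a b hab => cubic_sub_dom h2σ hN₀ hD hdn hdm hdnm k a b hab)
  have eq : collision n k - collision m k = ∫ a : E, (2 * ‖a‖)⁻¹ * ∫ b : ↥(ℝ ∙ a)ᗮ,
      (cubicForm n k (k + a) (k + a + b) (k + b) - cubicForm m k (k + a) (k + a + b) (k + b)) := by
    simp only [collision]
    rw [← integral_sub hn'.2.2.1 hm'.2.2.1]
    congr 1
    funext a
    rw [← mul_sub, ← integral_sub (hn'.1 a) (hm'.1 a)]
  rw [eq]
  calc |∫ a : E, (2 * ‖a‖)⁻¹ * ∫ b : ↥(ℝ ∙ a)ᗮ, (cubicForm n k (k + a) (k + a + b) (k + b)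
        - cubicForm m k (k + a) (k + a + b) (k + b))| ≤ K * A := hd'.2.2.2
    _ = 24 * (2 : ℝ) ^ (2 * σ) * A * N₀ ^ 2 * D * (1 + ‖k‖) ^ (-(2 * σ)) := by
        simp only [hK]; ring

end CollisionBounds

end WaveKinetic

end

end Literature.Analysis.FluidPDE
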